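import Summits.QuantumFields.YangMills.Theorems.LuscherReductionTwistedTraceScalingBOStiffCoreForm
import Summits.QuantumFields.YangMills.Theorems.LuscherReductionTwistedTraceScalingBOStiffCoreMass
import Summits.QuantumFields.YangMills.Theorems.LuscherReductionTwistedTraceScalingBOStiffFibreBlock
import Summits.QuantumFields.YangMills.Theorems.LuscherReductionTwistedTraceScalingBOStiffCoreCoeffInt
import Summits.QuantumFields.YangMills.Theorems.LuscherReductionTwistedTraceScalingBOStiffTailsRecord
import Summits.QuantumFields.YangMills.Theorems.LuscherReductionTwistedTraceScalingBODefectRecordData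
import HarnessLib

/-!
# (B-ST) (W1-7) `…BOStiffCore`: ★★★ `hcore_record_of_specs` — the CORE PIECE `hcore` of ✓`…BOStiffAssembly.hST_of_pieces` for the record data, CONDITIONAL on the two analytic specs
# (lane A of S-BASE, crux `TwistedTraceScaling` stmt-QuantumFields-20203, C4-CORE, the (B-ST) pen; HANDOFF-g21 UPDATE 20:39Z (W1-7))

Assuming, as explicit hypotheses, the conclusions of the lead's two fibre-block specs (`HOME/ym-luscher-20007-p1/g21-FibreBlock-spec.lean`, verbatim):
(A) `hS3` — upper quasimode + `L²(1/w)` defect of `cΘ` under `cM` with weight `cW` at level `cΛ`; (B) `hGI` — the door data at the central fibre (β-free `P₀, Cν, C'ν, cJ`;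
floor of `cΘ` on `cS`; `D, J₀`; `hν, hν', hJ, hflat`), this file proves
★★★ `hcore_record_of_specs` — `∃ M₀ ≥ 2, ∀ M ≥ M₀, ∃ θ₀ ∈ (0, 1/64], ∀ᶠ β, ∀ v` bounded measurable supported in `{recordChi L s 43 M β ≠ 0}` with `∀ u, fibreInner (softWeight χ) Ω_c v u = 0`:
`⟨P₀v₁, K_β P₀v₁⟩ ≤ (1 − 4θ₀)·Λ_rec(β)·tubeNormSq (softWeight χ) v`, `v₁ = 𝟙_{(S₂∪S₃)ᶜ} v` (the record cut sets of ✓`…BOStiffTailsRecord`), `θ₀ = θ_*/64`, `θ_* = cJ/(CνP₀)`.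
Chain: ✓`core_pairForm_le` (⟨P₀v₁,KP₀v₁⟩ = ∫∫ V G_β V ≤ slow ⊗ fibre bound) with `hnear` ✓`hnear_record` (rate `t = θ_*/16`), `hkop` ✓`hkop_record`, `hfib` ✓`StiffDoor.hfib_of_door` ∘ (✓`central_kform_data`,
(A), (B), weight floor ✓`eventually_cW_floor`); then `N ≤ (1+t²)‖v‖²_w` ✓`eventually_core_sq_norm_transport`, C-term `≤ t²‖v‖²_w` ✓`core_coeff_integral_le`, currency `κ₀cΛ ≤ (1+t²)Λ_rec`
✓`eventually_kappa_cLambda_le`, tail `≤ t²Λ_rec‖v‖²_w` ✓`eventually_tau_budget`, and ✓`core_budget_alg`.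
HONEST FRAMING: bookkeeping for a stub of a child of the CONDITIONAL route R2b1, CONDITIONAL on (A),(B); (B-ST) OPEN; C4-CORE OPEN; not infinite volume, not a gap, not Clay.
-/

set_option autoImplicit false

noncomputable section

open MeasureTheory Filter Topology Real
open scoped BigOperators
open Literature.MathematicalPhysics.QuantumFieldTheory
open Literature.MathematicalPhysics.QuantumLattice

namespace Summit.QuantumFields.YangMills.Theorems.FemtoTransferGap.TwoLattice.ConstTube

open Summit.QuantumFields.YangMills.Theorems.FemtoTransferGap
open Summit.QuantumFields.YangMills.Theorems.FemtoTransferGap.TwoLattice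
open Summit.QuantumFields.YangMills.Theorems.FemtoTransferGap.TwoLattice.Avg
open Summit.QuantumFields.YangMills.Theorems.FemtoTransferGap.TwoLattice.Stiff (LinkSpace)
open Summit.QuantumFields.YangMills.Theorems.FemtoTransferGap.TwoLattice.GnChart
open Summit.QuantumFields.YangMills.Theorems.TwistedTraceScaling.Negative

variable {L : ℕ} [NeZero L]

/-! ## ★★★ The core piece of record, conditional on the two specs -/

set_option maxHeartbeats 3200000 in
-- the full record assembly.
/-- ★★★ **`hcore` OF RECORD FROM THE TWO FIBRE-BLOCK SPECS** (see the module docstring). [cite: Luscher1983, §3] [cite: SeilerLNP1982, §3] -/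
theorem hcore_record_of_specs (hLz : Nonempty (NzSite L)) (hL2 : 2 ≤ L) {s : ℝ} (hs6 : 1 / 6 < s) (hs4 : s < 1 / 4)
    (hS3 : ∃ M₀ : ℝ, 2 ≤ M₀ ∧ ∀ M : ℝ, M₀ ≤ M → ∀ η : ℝ, 0 < η → ∀ η₂ : ℝ, 0 < η₂ → ∀ᶠ β : ℝ in atTop,
      (∀ x ∈ cS L β, ∫ y, cM L β x y * cΘ L β y ∂orthoTransverse L ≤ (1 + η) * cΛ L s M β * (cΘ L β x * cW L s M β x)) ∧
      (∫ x in cS L β, ((∫ y, cM L β x y * cΘ L β y ∂orthoTransverse L) - cΛ L s M β * (cΘ L β x * cW L s M β x)) ^ 2 / cW L s M β x ∂orthoTransverse L ≤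
        (η₂ * cΛ L s M β) ^ 2 * ∫ x, cΘ L β x ^ 2 * cW L s M β x ∂orthoTransverse L))
    (hGI : ∃ M₀ : ℝ, 2 ≤ M₀ ∧ ∀ M : ℝ, M₀ ≤ M → ∃ P₀ Cν C'ν cJ : ℝ, 0 < P₀ ∧ 0 < Cν ∧ 0 < C'ν ∧ 0 < cJ ∧ cJ / (Cν * P₀) ≤ 1 ∧
      ∀ δ : ℝ, 0 < δ → ∀ᶠ β : ℝ in atTop, ∃ (D : (Edge 3 L → Fin 3 → ℝ) → ℝ) (J₀ : (Edge 3 L → Fin 3 → ℝ) → (Edge 3 L → Fin 3 → ℝ) → ℝ) (θ₀ CD CJ : ℝ),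
        Measurable D ∧ (∀ x, |D x| ≤ CD) ∧ Measurable (Function.uncurry J₀) ∧ (∀ x y, |J₀ x y| ≤ CJ) ∧ 0 < θ₀ ∧ (∀ x ∈ cS L β, θ₀ ≤ cΘ L β x) ∧
        0 < ∫ x in cS L β, D x ∂orthoTransverse L ∧
        (∀ x ∈ cS L β, cΘ L β x ^ 2 * cW L s M β x ≤ Cν * D x) ∧ (∀ x ∈ cS L β, D x ≤ C'ν * (cΘ L β x ^ 2 * cW L s M β x)) ∧
        (∀ x y, cJ * (cΛ L s M β * J₀ x y) ≤ cΘ L β x * cM L β x y * cΘ L β y) ∧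
        (∀ g : (Edge 3 L → Fin 3 → ℝ) → ℝ, Measurable g → (∃ C : ℝ, ∀ x, |g x| ≤ C) → (∀ x, x ∉ cS L β → g x = 0) →
          (∫ x in cS L β, g x ^ 2 * D x ∂orthoTransverse L) - (∫ x in cS L β, g x * D x ∂orthoTransverse L) ^ 2 / (∫ x in cS L β, D x ∂orthoTransverse L) ≤
            P₀ * ((1 / 2) * ∫ x, ∫ y, (g x - g y) ^ 2 * J₀ x y ∂orthoTransverse L ∂orthoTransverse L) + δ * ∫ x in cS L β, g x ^ 2 * D x ∂orthoTransverse L)) :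
    ∃ M₀ : ℝ, 2 ≤ M₀ ∧ ∀ M : ℝ, M₀ ≤ M → ∃ θ₀ : ℝ, 0 < θ₀ ∧ θ₀ ≤ 1 / 64 ∧ ∀ᶠ β : ℝ in atTop,
      ∀ v : GaugeConfig 3 L SU2 → ℝ, Measurable v → (∃ C : ℝ, ∀ U, |v U| ≤ C) → (∀ U, v U ≠ 0 → recordChi L s 43 M β U ≠ 0) →
        (∀ u : GaugeConfig 3 1 SU2, fibreInner L (softWeight (recordChi L s 43 M β)) (fun x : LinkSpace L => {x : LinkSpace L | linkCurry x ∈ capBalancedSet L}.indicator (fun _ => (1 : ℝ)) x *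
          frozenProfile L (fun β' => stiffGaussExp L (β' / 2) β') (fun β' => min (1 / 40) (powScale (1 / 2) β' * btLog β')) β x) v u = 0) →
        qform su2Rep β
            (fun U => ∫ h, ({U : GaugeConfig 3 L SU2 | powScale 1 β * btLog β < ‖(gaugeModes L).starProjection (relLinkVec L U)‖} ∪
                {U : GaugeConfig 3 L SU2 | min (1 / 40) (powScale (1 / 2) β * btLog β) / 2 < ‖relLinkVec L U‖})ᶜ.indicator v (gaugeTransform (basedExt L h) U) ∂basedMeasure L)
            (fun U => ∫ h, ({U : GaugeConfig 3 L SU2 | powScale 1 β * btLog β < ‖(gaugeModes L).starProjection (relLinkVec L U)‖} ∪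
                {U : GaugeConfig 3 L SU2 | min (1 / 40) (powScale (1 / 2) β * btLog β) / 2 < ‖relLinkVec L U‖})ᶜ.indicator v (gaugeTransform (basedExt L h) U) ∂basedMeasure L) ≤
          (1 - 4 * θ₀) * (btC L β (fun x : LinkSpace L => {x : LinkSpace L | linkCurry x ∈ capBalancedSet L}.indicator (fun _ => (1 : ℝ)) x * frozenProfile L (fun β' => stiffGaussExp L (β' / 2) β') (fun β' => min (1 / 40) (powScale (1 / 2) β' * btLog β')) β x) (btEps β) (5 * (powScale (1 / 2) β * btLog β ^ 2)) / fpZ (btEps β) / recordGamma L (fun β' => fun x : LinkSpace L => {x : LinkSpace L | linkCurry x ∈ capBalancedSet L}.indicator (fun _ => (1 : ℝ)) x * frozenProfile L (fun β'' => stiffGaussExp L (β'' / 2) β'') (fun β'' => min (1 / 40) (powScale (1 / 2) β'' * btLog β'')) β' x) β *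
            levelValue su2Rep 1 ((L : ℝ) ^ 3 * β) 0) * tubeNormSq (softWeight (recordChi L s 43 M β)) v := by
  haveI := isFiniteMeasure_orthoTransverse L
  have hs : 0 < s := by linarith
  have hs3 : s ≤ 1 / 3 := by linarith
  obtain ⟨M₁, hM₁, H1⟩ := hS3
  obtain ⟨M₂, hM₂, H2⟩ := hGI
  obtain ⟨M₃, hM₃, H3⟩ := eventually_core_sq_norm_transport (L := L) hLz hs hs3
  obtain ⟨M₄, hM₄, H4⟩ := core_coeff_integral_le (L := L) hLz hL2 hs hs3
  obtain ⟨M₅, hM₅, H5⟩ := eventually_kappa_cLambda_le (L := L) hLz hs hs3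
  obtain ⟨M₆, hM₆, H6⟩ := eventually_cW_floor (L := L) hLz hs hs3
  obtain ⟨cΛf, Kf, hcΛf, hfloorΛ⟩ := recordLambda_floor (L := L)
  refine ⟨max (max (max M₁ M₂) (max M₃ M₄)) (max M₅ M₆), le_trans hM₁ (le_trans (le_max_left _ _) (le_trans (le_max_left _ _) (le_max_left _ _))), fun M hM => ?_⟩
  have hM1 : M₁ ≤ M := le_trans (le_trans (le_max_left _ _) (le_max_left _ _)) (le_trans (le_max_left _ _) hM)
  have hM2 : M₂ ≤ M := le_trans (le_trans (le_max_right _ _) (le_max_left _ _)) (le_trans (le_max_left _ _) hM)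
  have hM3 : M₃ ≤ M := le_trans (le_trans (le_max_left _ _) (le_max_right _ _)) (le_trans (le_max_left _ _) hM)
  have hM4 : M₄ ≤ M := le_trans (le_trans (le_max_right _ _) (le_max_right _ _)) (le_trans (le_max_left _ _) hM)
  have hM5 : M₅ ≤ M := le_trans (le_max_left _ _) (le_trans (le_max_right _ _) hM)
  have hM6 : M₆ ≤ M := le_trans (le_max_right _ _) (le_trans (le_max_right _ _) hM)
  have hM0 : 0 ≤ M := le_trans (by norm_num) (hM₁.trans hM1)
  obtain ⟨P₀, Cν, C'ν, cJ, hP₀, hCν, hC'ν, hcJ, hgain, HGI⟩ := H2 M hM2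
  -- the rates
  have hθs0 : 0 < cJ / (Cν * P₀) := div_pos hcJ (mul_pos hCν hP₀)
  set t : ℝ := cJ / (Cν * P₀) / 16 with htdef
  have ht0 : 0 < t := by positivity
  have ht16 : t ≤ 1 / 16 := by rw [htdef]; linarith
  have ht2 : 0 < t ^ 2 := by positivity
  set δd : ℝ := 1 / (4 * (Cν * C'ν)) with hδd
  have hδd0 : 0 < δd := by positivity
  have hδd1 : Cν * δd * C'ν = 1 / 4 := by rw [hδd]; field_simp
  refine ⟨cJ / (Cν * P₀) / 64, by positivity, by linarith, ?_⟩
  have hN0 : (0 : ℝ) ≤ 517 / (Fintype.card (Site 3 L) : ℝ) := by positivity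
  have hmass0 : 0 ≤ 2 * ((configMeasure SU2 1).prod (orthoTransverse L)).real Set.univ := by positivity
  filter_upwards [H1 M hM1 t ht0 t ht0, HGI δd hδd0, H3 M hM3 (t ^ 2) ht2, H4 M hM4 (t ^ 2) ht2, H5 M hM5 (t ^ 2) ht2, H6 M hM6,
    eventually_tau_budget (L := L) hmass0 ht2, hnear_record (L := L) hs hN0 ht0, recordChi_support (L := L) hs hM0, eventually_ge_atTop (0 : ℝ), hfloorΛ]
    with β hAβ hBβ hTβ hCβ hKβ hFβ hτβ hnβ hsuppβ hβ0 hΛfl v hv hCv hvχ hadm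
  obtain ⟨hup, hdef⟩ := hAβ
  obtain ⟨D, J₀, θf, CD, CJ, hDm, hDb, hJ₀m, hJ₀b, hθf, hΘlo, hZD, hν, hν', hJ, hflat⟩ := hBβ
  obtain ⟨Cv, hCv⟩ := hCv
  obtain ⟨hMm, ⟨CM, hMb⟩, hsymm, hpsd, hΘm, hΘ1, hΘ0, hΘS, hSm⟩ := central_kform_data (L := L) hβ0
  obtain ⟨hwm, hwb, hw0⟩ := cW_props (L := L) s M β
  obtain ⟨hZS, hZ, hΛpos⟩ := central_mass_pos (L := L) hβ0 hDm hDb hC'ν hθf hΘlo hZD hν' ht0.le hup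
  have hΛrec0 : 0 ≤ btC L β (fun x : LinkSpace L => {x : LinkSpace L | linkCurry x ∈ capBalancedSet L}.indicator (fun _ => (1 : ℝ)) x * frozenProfile L (fun β' => stiffGaussExp L (β' / 2) β') (fun β' => min (1 / 40) (powScale (1 / 2) β' * btLog β')) β x) (btEps β) (5 * (powScale (1 / 2) β * btLog β ^ 2)) / fpZ (btEps β) / recordGamma L (fun β' => fun x : LinkSpace L => {x : LinkSpace L | linkCurry x ∈ capBalancedSet L}.indicator (fun _ => (1 : ℝ)) x * frozenProfile L (fun β'' => stiffGaussExp L (β'' / 2) β'') (fun β'' => min (1 / 40) (powScale (1 / 2) β'' * btLog β'')) β' x) β *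
      levelValue su2Rep 1 ((L : ℝ) ^ 3 * β) 0 :=
    le_trans (mul_nonneg (mul_nonneg hcΛf.le (pow_nonneg (powScale_pos 1 β).le _)) (pow_nonneg (Real.exp_pos _).le _)) hΛfl
  -- names
  set rf : ℝ := min (1 / 40) (powScale (1 / 2) β * btLog β) with hrfdef
  have hrf0 : 0 < rf := lt_min (by norm_num) (mul_pos (powScale_pos _ _) (lt_of_lt_of_le one_pos (one_le_btLog β)))
  set χ := recordChi L s 43 M β with hχdef
  set S₂ : Set (GaugeConfig 3 L SU2) := {U | powScale 1 β * btLog β < ‖(gaugeModes L).starProjection (relLinkVec L U)‖} with hS₂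
  set S₃ : Set (GaugeConfig 3 L SU2) := {U | rf / 2 < ‖relLinkVec L U‖} with hS₃
  set v₁ : GaugeConfig 3 L SU2 → ℝ := (S₂ ∪ S₃)ᶜ.indicator v with hv₁def
  have hS23 : MeasurableSet (S₂ ∪ S₃) := (measurableSet_far_record (L := L) _).union (measurableSet_shell_record (L := L) _)
  have hv₁m : Measurable v₁ := hv.indicator hS23.compl
  have hCv0 : 0 ≤ Cv := (abs_nonneg _).trans (hCv 1)
  have hv₁b : ∀ U, |v₁ U| ≤ Cv := fun U => by
    rw [hv₁def]; by_cases hU : U ∈ (S₂ ∪ S₃)ᶜ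
    · rw [Set.indicator_of_mem hU]; exact hCv U
    · rw [Set.indicator_of_notMem hU, abs_zero]; exact hCv0
  have hv₁v : ∀ U, v₁ U ≠ 0 → v U ≠ 0 ∧ U ∈ (S₂ ∪ S₃)ᶜ := fun U hU => by
    rw [hv₁def] at hU
    by_cases hm : U ∈ (S₂ ∪ S₃)ᶜ
    · rw [Set.indicator_of_mem hm] at hU; exact ⟨hU, hm⟩
    · exact absurd (Set.indicator_of_notMem hm v) hU
  have h0 : ∀ U, v₁ U ≠ 0 → U ∈ orthoTubeSet L := fun U hU => (hsuppβ U (hvχ U (hv₁v U hU).1)).2.2.1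
  have hvwin : ∀ U, v₁ U ≠ 0 → ∀ k : Fin 3, ‖su2Quat (slowMean L U (0, k)) - 1‖ ≤ 517 / (Fintype.card (Site 3 L) : ℝ) * powScale s β :=
    fun U hU => (hsuppβ U (hvχ U (hv₁v U hU).1)).2.2.2.1
  have hvR2 : ∀ U, v₁ U ≠ 0 → ‖relLinkVec L U‖ ≤ rf / 2 := fun U hU => by
    have hm := (hv₁v U hU).2
    rw [Set.mem_compl_iff, Set.mem_union, not_or] at hm
    exact not_lt.mp hm.2
  have hvR : ∀ U, v₁ U ≠ 0 → ‖relLinkVec L U‖ ≤ rf := fun U hU => (hvR2 U hU).trans (by linarith)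
  have hVS : ∀ (u : GaugeConfig 3 1 SU2) (x : Edge 3 L → Fin 3 → ℝ), x ∉ cS L β → (capBalancedSet L).indicator (fun x => v₁ (orthoTube L u x)) x = 0 :=
    fun u x hx => tubeTest_support (L := L) (R := rf / 2) (by rw [hrfdef]; linarith) hvR2 u x hx
  -- the fibre block
  have hwlo : ∀ x ∈ cS L β, fpWeightBar L (powScale 1 β) / 2 ≤ cW L s M β x := fun x hx => hFβ x (mem_cS hx).1 (mem_cS hx).2
  have hw00 : 0 < fpWeightBar L (powScale 1 β) / 2 := by have := fpWeightBar_pos L (powScale_pos 1 β); linarith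
  have hfib := StiffDoor.hfib_of_door (μ := orthoTransverse L) hMm hMb hsymm hpsd hΘm hΘ1 hΘ0 hΘS hθf hΘlo hwm hwb hSm hw00 hwlo hZS hΛpos ht0.le ht0.le
    hup hdef hDm hDb hJ₀m hJ₀b hZD hν hCν hν' hC'ν hJ hcJ hP₀ hgain hδd0.le hflat
  -- `0 ≤ 1 − θ₁ = 1 + t − θ_*(1 − ¼)`
  have hθ0' : 0 ≤ 1 + t - cJ / (Cν * P₀) * (1 - Cν * δd * C'ν) := by rw [hδd1]; nlinarith [hgain, hθs0]
  have hθ' : 1 + t - cJ / (Cν * P₀) * (1 - Cν * δd * C'ν) ≤ 1 - 11 * t := by rw [hδd1, htdef]; nlinarith [hθs0]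
  -- ★ the slow ⊗ fibre assembly
  have hmain := core_pairForm_le (L := L) hβ0 hv₁m hv₁b h0 hvwin hvR hVS hwm hwb hw0 hΘm hΘ1 hZ
    (Λ := cΛ L s M β) (θ₁ := 1 - (1 + t - cJ / (Cν * P₀) * (1 - Cν * δd * C'ν))) (A₁ := 1 + t) (A₂ := t) (ηt := t)
    hΛpos.le (by rw [sub_sub_cancel]; exact hθ0') (by positivity) ht0.le ht0.le (hnβ) (by simpa only [sub_sub_cancel] using hfib) (hkop_record (L := L) hβ0)
  rw [sub_sub_cancel] at hmain
  refine hmain.trans ?_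
  -- ★ the conversions
  obtain ⟨hVm, hVb⟩ := tubeTest_props (L := L) hv₁m hv₁b
  obtain ⟨hswm, hswb, hsw0, -⟩ := softWeight_recordChi_props (L := L) s 43 M β
  have hX0 : 0 ≤ tubeNormSq (softWeight χ) v := tubeNormSq_nonneg hsw0
  set X := tubeNormSq (softWeight χ) v with hXdef
  set LAM := btC L β (fun x : LinkSpace L => {x : LinkSpace L | linkCurry x ∈ capBalancedSet L}.indicator (fun _ => (1 : ℝ)) x * frozenProfile L (fun β' => stiffGaussExp L (β' / 2) β') (fun β' => min (1 / 40) (powScale (1 / 2) β' * btLog β')) β x) (btEps β) (5 * (powScale (1 / 2) β * btLog β ^ 2)) / fpZ (btEps β) / recordGamma L (fun β' => fun x : LinkSpace L => {x : LinkSpace L | linkCurry x ∈ capBalancedSet L}.indicator (fun _ => (1 : ℝ)) x * frozenProfile L (fun β'' => stiffGaussExp L (β'' / 2) β'') (fun β'' => min (1 / 40) (powScale (1 / 2) β'' * btLog β'')) β' x) β *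
      levelValue su2Rep 1 ((L : ℝ) ^ 3 * β) 0 with hLAM
  -- (2) `N ≤ (1+t²)X`
  obtain ⟨hT1, hT2⟩ := hTβ v hv ⟨Cv, hCv⟩ hvχ
  have hFm : Measurable fun p : GaugeConfig 3 1 SU2 × (Edge 3 L → Fin 3 → ℝ) => (capBalancedSet L).indicator (fun x => v₁ (orthoTube L p.1 x)) p.2 ^ 2 * cW L s M β p.2 :=
    (hVm.pow_const 2).mul (hwm.comp measurable_snd)
  have hFb : ∀ p : GaugeConfig 3 1 SU2 × (Edge 3 L → Fin 3 → ℝ), |(capBalancedSet L).indicator (fun x => v₁ (orthoTube L p.1 x)) p.2 ^ 2 * cW L s M β p.2| ≤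
      Cv ^ 2 * Real.exp ((Fintype.card (Edge 3 L) : ℝ) / powScale 1 β ^ 2) := fun p => by
    rw [abs_mul, abs_pow]; exact mul_le_mul (pow_le_pow_left₀ (abs_nonneg _) (hVb p) 2) (hwb _) (abs_nonneg _) (sq_nonneg _)
  have hGm : Measurable fun p : GaugeConfig 3 1 SU2 × (Edge 3 L → Fin 3 → ℝ) => v₁ (orthoTube L p.1 p.2) ^ 2 * softWeight χ (orthoTube L 1 p.2) :=
    ((hv₁m.comp (measurable_orthoTube (L := L))).pow_const 2).mul (hswm.comp ((measurable_orthoTube_right (L := L) 1).comp measurable_snd))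
  have hGb : ∀ p : GaugeConfig 3 1 SU2 × (Edge 3 L → Fin 3 → ℝ), |v₁ (orthoTube L p.1 p.2) ^ 2 * softWeight χ (orthoTube L 1 p.2)| ≤
      Cv ^ 2 * Real.exp ((Fintype.card (Edge 3 L) : ℝ) / powScale 1 β ^ 2) := fun p => by
    rw [abs_mul, abs_pow]; exact mul_le_mul (pow_le_pow_left₀ (abs_nonneg _) (hv₁b _) 2) (hswb _) (abs_nonneg _) (sq_nonneg _)
  have hFG : ∀ p : GaugeConfig 3 1 SU2 × (Edge 3 L → Fin 3 → ℝ), (capBalancedSet L).indicator (fun x => v₁ (orthoTube L p.1 x)) p.2 ^ 2 * cW L s M β p.2 ≤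
      v₁ (orthoTube L p.1 p.2) ^ 2 * softWeight χ (orthoTube L 1 p.2) := fun p => by
    by_cases hp : p.2 ∈ capBalancedSet L
    · rw [Set.indicator_of_mem hp]; exact le_rfl
    · rw [Set.indicator_of_notMem hp]; simp only [ne_eq, OfNat.ofNat_ne_zero, not_false_eq_true, zero_pow, zero_mul]
      exact mul_nonneg (sq_nonneg _) (hsw0 _)
  have hN1 := iter_integral_mono (ν := configMeasure SU2 1) (μ := orthoTransverse L) hFm hFb hGm hGb hFG
  have hNle : ∫ u, ∫ x, (capBalancedSet L).indicator (fun x => v₁ (orthoTube L u x)) x ^ 2 * cW L s M β x ∂orthoTransverse L ∂configMeasure SU2 1 ≤ (1 + t ^ 2) * X :=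
    hN1.trans (hT1.trans (mul_le_mul_of_nonneg_left hT2 (by positivity)))
  have hNn : 0 ≤ ∫ u, ∫ x, (capBalancedSet L).indicator (fun x => v₁ (orthoTube L u x)) x ^ 2 * cW L s M β x ∂orthoTransverse L ∂configMeasure SU2 1 :=
    integral_nonneg fun u => integral_nonneg fun x => mul_nonneg (sq_nonneg _) (hw0 x)
  -- (3) the C-term
  have eC : (fun u : GaugeConfig 3 1 SU2 => (∫ x, (capBalancedSet L).indicator (fun x => v₁ (orthoTube L u x)) x * cΘ L β x * cW L s M β x ∂orthoTransverse L) ^ 2 /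
        ∫ x, cΘ L β x ^ 2 * cW L s M β x ∂orthoTransverse L) =
      fun u => (∫ x, v₁ (orthoTube L u x) * ({x : LinkSpace L | linkCurry x ∈ capBalancedSet L}.indicator (fun _ => (1 : ℝ)) (linkEmbed L x) *
          frozenProfile L (fun β' => stiffGaussExp L (β' / 2) β') (fun β' => min (1 / 40) (powScale (1 / 2) β' * btLog β')) β (linkEmbed L x)) *
          softWeight χ (orthoTube L 1 x) ∂orthoTransverse L) ^ 2 / fibreMass L (softWeight χ) (cΩ L β) 1 := by
    funext u
    rw [fibreMass_eq_cMass]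
    congr 2
    refine integral_congr_ae (ae_of_all _ fun x => ?_)
    show (capBalancedSet L).indicator (fun x => v₁ (orthoTube L u x)) x * cΘ L β x * cW L s M β x =
      v₁ (orthoTube L u x) * ({x : LinkSpace L | linkCurry x ∈ capBalancedSet L}.indicator (fun _ => (1 : ℝ)) (linkEmbed L x) *
          frozenProfile L (fun β' => stiffGaussExp L (β' / 2) β') (fun β' => min (1 / 40) (powScale (1 / 2) β' * btLog β')) β (linkEmbed L x)) *
        softWeight χ (orthoTube L 1 x)
    by_cases hx : x ∈ capBalancedSet L
    · rw [Set.indicator_of_mem hx]; rfl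
    · rw [Set.indicator_of_notMem hx, zero_mul, zero_mul]
      have hlc : linkEmbed L x ∉ {y : LinkSpace L | linkCurry y ∈ capBalancedSet L} := by
        intro h; apply hx
        have e : linkCurry (linkEmbed L x) = x := by funext e a; rfl
        have h2 : linkCurry (linkEmbed L x) ∈ capBalancedSet L := h
        rwa [e] at h2
      rw [Set.indicator_of_notMem hlc, zero_mul, mul_zero, zero_mul]
  have hCle : ∫ u, (∫ x, (capBalancedSet L).indicator (fun x => v₁ (orthoTube L u x)) x * cΘ L β x * cW L s M β x ∂orthoTransverse L) ^ 2 /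
        (∫ x, cΘ L β x ^ 2 * cW L s M β x ∂orthoTransverse L) ∂configMeasure SU2 1 ≤ t ^ 2 * X := by
    have h := hCβ v hv ⟨Cv, hCv⟩ hvχ hadm
    rw [show (fun u : GaugeConfig 3 1 SU2 => (∫ x, (capBalancedSet L).indicator (fun x => v₁ (orthoTube L u x)) x * cΘ L β x * cW L s M β x ∂orthoTransverse L) ^ 2 /
        (∫ x, cΘ L β x ^ 2 * cW L s M β x ∂orthoTransverse L)) = _ from eC]
    exact h
  have hCn : 0 ≤ ∫ u, (∫ x, (capBalancedSet L).indicator (fun x => v₁ (orthoTube L u x)) x * cΘ L β x * cW L s M β x ∂orthoTransverse L) ^ 2 /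
        (∫ x, cΘ L β x ^ 2 * cW L s M β x ∂orthoTransverse L) ∂configMeasure SU2 1 :=
    integral_nonneg fun u => div_nonneg (sq_nonneg _) hZ.le
  -- (4) the tail term
  have hI1 := sq_integral_abs_le_mass_mul (μ := (configMeasure SU2 1).prod (orthoTransverse L)) hVm hVb
  have hVsq_m : Measurable fun p : GaugeConfig 3 1 SU2 × (Edge 3 L → Fin 3 → ℝ) => (capBalancedSet L).indicator (fun x => v₁ (orthoTube L p.1 x)) p.2 ^ 2 := hVm.pow_const 2
  have hVsq_b : ∀ p : GaugeConfig 3 1 SU2 × (Edge 3 L → Fin 3 → ℝ), |(capBalancedSet L).indicator (fun x => v₁ (orthoTube L p.1 x)) p.2 ^ 2| ≤ Cv ^ 2 := fun p => by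
    rw [abs_pow]; exact pow_le_pow_left₀ (abs_nonneg _) (hVb p) 2
  have hptw : ∀ p : GaugeConfig 3 1 SU2 × (Edge 3 L → Fin 3 → ℝ), (capBalancedSet L).indicator (fun x => v₁ (orthoTube L p.1 x)) p.2 ^ 2 ≤
      (capBalancedSet L).indicator (fun x => v₁ (orthoTube L p.1 x)) p.2 ^ 2 * cW L s M β p.2 / (fpWeightBar L (powScale 1 β) / 2) := fun p => by
    by_cases hp : p.2 ∈ capBalancedSet L
    · rw [Set.indicator_of_mem hp]
      by_cases hz : v₁ (orthoTube L p.1 p.2) = 0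
      · rw [hz]; simp
      · have hR : ‖linkEmbed L p.2‖ ≤ rf := by rw [← relLinkVec_orthoTube L p.1 hp]; exact hvR _ hz
        have hwp := hFβ p.2 hp hR
        rw [le_div_iff₀ hw00]
        exact mul_le_mul_of_nonneg_left hwp (sq_nonneg _)
    · rw [Set.indicator_of_notMem hp]; simp
  have hI2 : ∫ p, (capBalancedSet L).indicator (fun x => v₁ (orthoTube L p.1 x)) p.2 ^ 2 ∂(configMeasure SU2 1).prod (orthoTransverse L) ≤
      (∫ p, (capBalancedSet L).indicator (fun x => v₁ (orthoTube L p.1 x)) p.2 ^ 2 * cW L s M β p.2 ∂(configMeasure SU2 1).prod (orthoTransverse L)) /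
        (fpWeightBar L (powScale 1 β) / 2) := by
    rw [← integral_div]
    exact integral_mono (integrable_of_measurable_abs_le _ hVsq_m hVsq_b) ((integrable_of_measurable_abs_le _ hFm hFb).div_const _) hptw
  have hI3 : ∫ p, (capBalancedSet L).indicator (fun x => v₁ (orthoTube L p.1 x)) p.2 ^ 2 * cW L s M β p.2 ∂(configMeasure SU2 1).prod (orthoTransverse L) =
      ∫ u, ∫ x, (capBalancedSet L).indicator (fun x => v₁ (orthoTube L u x)) x ^ 2 * cW L s M β x ∂orthoTransverse L ∂configMeasure SU2 1 :=
    (iter_integral_eq_prod (ν := configMeasure SU2 1) (μ := orthoTransverse L) hFm hFb).symm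
  have hmassP : 0 ≤ ((configMeasure SU2 1).prod (orthoTransverse L)).real Set.univ := measureReal_nonneg
  have hτle : Real.exp (β * (2 * (Fintype.card (Edge 3 L) : ℝ))) * (4 * Real.exp (-(btLog β ^ 2))) *
      (∫ p, |(capBalancedSet L).indicator (fun x => v₁ (orthoTube L p.1 x)) p.2| ∂(configMeasure SU2 1).prod (orthoTransverse L)) ^ 2 ≤ t ^ 2 * LAM * X := by
    have h2X : ∫ u, ∫ x, (capBalancedSet L).indicator (fun x => v₁ (orthoTube L u x)) x ^ 2 * cW L s M β x ∂orthoTransverse L ∂configMeasure SU2 1 ≤ 2 * X :=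
      hNle.trans (mul_le_mul_of_nonneg_right (by nlinarith) hX0)
    have hsq : (∫ p, |(capBalancedSet L).indicator (fun x => v₁ (orthoTube L p.1 x)) p.2| ∂(configMeasure SU2 1).prod (orthoTransverse L)) ^ 2 ≤
        ((configMeasure SU2 1).prod (orthoTransverse L)).real Set.univ * (2 * X / (fpWeightBar L (powScale 1 β) / 2)) := by
      refine hI1.trans (mul_le_mul_of_nonneg_left ?_ hmassP)
      refine hI2.trans ?_
      rw [hI3]; exact div_le_div_of_nonneg_right h2X hw00.le
    have e : ((configMeasure SU2 1).prod (orthoTransverse L)).real Set.univ * (2 * X / (fpWeightBar L (powScale 1 β) / 2)) =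
        (2 * ((configMeasure SU2 1).prod (orthoTransverse L)).real Set.univ / (fpWeightBar L (powScale 1 β) / 2)) * X := by
      field_simp
    rw [e] at hsq
    have hτ0 : 0 ≤ Real.exp (β * (2 * (Fintype.card (Edge 3 L) : ℝ))) * (4 * Real.exp (-(btLog β ^ 2))) := by positivity
    calc _ ≤ Real.exp (β * (2 * (Fintype.card (Edge 3 L) : ℝ))) * (4 * Real.exp (-(btLog β ^ 2))) *
          ((2 * ((configMeasure SU2 1).prod (orthoTransverse L)).real Set.univ / (fpWeightBar L (powScale 1 β) / 2)) * X) := mul_le_mul_of_nonneg_left hsq hτ0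
      _ = Real.exp (β * (2 * (Fintype.card (Edge 3 L) : ℝ))) * (4 * Real.exp (-(btLog β ^ 2))) *
          (2 * ((configMeasure SU2 1).prod (orthoTransverse L)).real Set.univ / (fpWeightBar L (powScale 1 β) / 2)) * X := by ring
      _ ≤ t ^ 2 * LAM * X := mul_le_mul_of_nonneg_right hτβ hX0
  -- (5) the closing algebra
  have hfin := core_budget_alg (t := t) (Λ := LAM) (X := X) ht0.le ht16 hΛrec0 hX0 hNn hCn hKβ hNle hCle hτle hθ0' hθ' (by positivity) le_rfl ht0.le le_rfl ht0.le le_rfl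
  have e4 : 1 - 4 * (cJ / (Cν * P₀) / 64) = 1 - t := by rw [htdef]; ring
  rw [e4]
  exact hfin

end Summit.QuantumFields.YangMills.Theorems.FemtoTransferGap.TwoLattice.ConstTube

end
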